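import Summits.RiemannHypothesis.RiemannHypothesis.Theorems.SignConeKreinTuranTheoremA
import Summits.RiemannHypothesis.RiemannHypothesis.Theorems.SignConeKreinTuranSchurCert210

/-!
# Route SignCone — Krein–Turán rung, VII: the Platt–Trudgian instance at the 2001 benchmark `x = 210`

Support for the crux `SignConeInequality` (stmt-RiemannHypothesis-16301; plan `Cruxes/SignConeInequality/KREIN-TURAN-RUNG.md` §2, §4).
**Theorem A′ instantiated**: the named hypothesis `platt_trudgian_numerical_rh` (every zero of `ζ` with `0 < Im ρ ≤ 3 000 175 332 800`
is on the critical line) implies Weil's functional with UNIT SLACK on every test supported in `[-1337/500, 1337/500]`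
(`unitSlackWeil_log210_of_plattTrudgian`; `1337/500 = 2.674 > (log 210)/2`), hence the route items `SignConeInequality` /
`SignConeOscillatory` for all cutoffs `a ≤ (log 210)/2` — the 2001 benchmark `x = e^{2a} = 210` of the archive — and for
`a ≤ 1337/500` (`signConeInequality_upTo_log210half_of_plattTrudgian`, …). The prime comb is charged to the kernel-checked
Krein–Turán bound `Π(210, 107/20) ≤ 20` (`kreinTuranBound_210`, Schur certificate `schurCert210`); NO pointwise comb bound,
no SOS. Parameters: `b′ = 107/40`, plateau kernel `⟨107/20, 2, []⟩` (`C_E ≤ 108`), mollifier `m = 9`, `h = 1/(4·10¹¹)`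
(`hH ≈ 7.5`), `Y = 4·10¹⁰` (`hY = 1/10`, `δ′ = 1/900`), `B = 4.3723 + 432`, `τ′ ≤ 0.0218`; side condition
`τ′ + δ′(B + Π + 1) ≤ 0.53 ≤ 1`, high-frequency credit `log(Y/2) − log π + 1 − … ≥ 23.55 ≥ Π + 1 = 21`.
CONDITIONAL on the named fact `platt_trudgian_numerical_rh` (a published large computation, not provable in-tree).
Growth with the cutoff: the only cutoff-sensitive input is `Π(N) ≈ 1.15 e^{b}` against the credit `≈ log(Y/2) − 0.14` with
`Y ≲ H/(7.5·10)`; at `H = 3·10¹²` the architecture ends near `Π ≈ 22.5`, i.e. `N ≈ 400`, `b ≈ 3.0`.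
-/

noncomputable section

-- `Summit.RiemannHypothesis.RiemannHypothesis.…` repeats a namespace component by design (D-0017 layout).
set_option linter.dupNamespace false

open scoped BigOperators ComplexConjugate Real Topology ArithmeticFunction.vonMangoldt
open Complex MeasureTheory Set Filter

namespace Summit.RiemannHypothesis.RiemannHypothesis.Theorems.SignCone

open Literature.NumberTheory.LFunctions Literature.Analysis.SpecialFunctions
open Literature.NumberTheory.LFunctions.ZetaZeroTails (tailInvImSq tailInvImSq_le tailInvImSq_nonneg)
open Literature.Analysis.ValidatedNumerics.Numerics

/-! ### Data and numerical lemmas -/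

/-- The plateau kernel `χ ≡ 1` on `[0, 107/20]`, linear to `0` on `[107/20, 147/20]`. [folklore] -/
def ktKernel : PWKernel := ⟨107 / 20, 2, []⟩

/-- Engine enclosure of `e^q` from below: if `expFI q = some E` with `r ≤ E.lo` then `r ≤ e^q`. [folklore] -/
theorem exp_ge_of_expFI {q r : ℚ}
    (h : (match PW.expFI q with | some E => decide (r ≤ E.loQ) | none => false) = true) :
    (r : ℝ) ≤ Real.exp q := by
  split at h
  · rename_i E hE
    rw [decide_eq_true_eq] at h
    exact le_trans (by exact_mod_cast h) (FI.loQ_le (PW.mem_expFI hE))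
  · simp at h

/-- `e^{1337/500} ≤ 14.5`. [folklore] -/
theorem exp_2674_le : Real.exp (1337 / 500) ≤ 29 / 2 := by
  have := exp_le_of_expFI (q := 1337 / 500) (r := 29 / 2) (by decide +kernel)
  push_cast at this; exact this

/-- `e^{147/40} ≤ 39.46`. [folklore] -/
theorem exp_3675_le : Real.exp (147 / 40) ≤ 3946 / 100 := by
  have := exp_le_of_expFI (q := 147 / 40) (r := 3946 / 100) (by decide +kernel)
  push_cast at this; exact this

/-- `e^{107/40} ≤ 14.53`. [folklore] -/
theorem exp_2675_le : Real.exp (107 / 40) ≤ 1453 / 100 := by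
  have := exp_le_of_expFI (q := 107 / 40) (r := 1453 / 100) (by decide +kernel)
  push_cast at this; exact this

/-- `e^{107/20} < 211`. [folklore] -/
theorem exp_535_lt : Real.exp (107 / 20) < 211 := by
  have := exp_le_of_expFI (q := 107 / 20) (r := 2107 / 10) (by decide +kernel)
  push_cast at this; linarith

/-- `210 ≤ e^{1337/250}`, i.e. `(log 210)/2 ≤ 1337/500`. [folklore] -/
theorem exp_5348_ge : (210 : ℝ) ≤ Real.exp (1337 / 250) := by
  have := exp_ge_of_expFI (q := 1337 / 250) (r := 210) (by decide +kernel)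
  push_cast at this; exact this

/-- `(log 210)/2 ≤ 1337/500`. [folklore] -/
theorem log_210_half_le : Real.log 210 / 2 ≤ 1337 / 500 := by
  rw [div_le_iff₀ (by norm_num : (0 : ℝ) < 2), Real.log_le_iff_le_exp (by norm_num)]
  have := exp_5348_ge
  rw [show (1337 / 500 : ℝ) * 2 = 1337 / 250 by norm_num]
  exact this

/-- `e^{23.7} ≤ 2·10¹⁰` (`(e^{2.37})^{10}`). [folklore] -/
theorem exp_237_10_le : Real.exp (237 / 10) ≤ 20000000000 := by
  have h1 := exp_le_of_expFI (q := 237 / 100) (r := 107 / 10) (by decide +kernel)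
  push_cast at h1
  have e : Real.exp (237 / 10) = Real.exp (237 / 100) ^ 10 := by
    rw [← Real.exp_nat_mul]; norm_num
  rw [e]
  calc Real.exp (237 / 100) ^ 10 ≤ ((107 : ℝ) / 10) ^ 10 :=
        pow_le_pow_left₀ (Real.exp_pos _).le h1 10
    _ ≤ 20000000000 := by norm_num

/-- `C_E ≤ 108` for the plateau kernel. [folklore] -/
theorem decayConst_ktKernel_le : ktKernel.decayConst ≤ 108 := by
  unfold PWKernel.decayConst PWKernel.K PWKernel.knot
  simp only [ktKernel, List.length_nil, zero_add, Finset.Ico_self, Finset.sum_empty, add_zero]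
  push_cast
  have h1 := exp_3675_le
  have h2 := exp_2675_le
  norm_num at h1 h2 ⊢
  linarith

/-! ### The instance -/

/-- **Weil's functional with unit slack at cutoff `1337/500 (> (log 210)/2)`, from Platt–Trudgian, Krein–Turán form**:
`platt_trudgian_numerical_rh → ∀ g ∈ C_c^∞[-1337/500, 1337/500], −‖g‖₂² ≤ Re W(g ⋆ g̃)`. CONDITIONAL on the named hypothesis.
[cite: PlattTrudgianBLMS2021, Theorem 1] -/
theorem unitSlackWeil_log210_of_plattTrudgian (hPT : platt_trudgian_numerical_rh) :
    ∀ g : ℝ → ℂ, IsWeilTest g → tsupport g ⊆ Icc (-(1337 / 500 : ℝ)) (1337 / 500) →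
      -weilNorm2Sq g ≤ (weilFunctional (weilConv g (weilReflect g))).re := by
  intro g hg hs
  have hRH : RiemannHypothesisInStripUpTo 3000175332800 := platt_trudgian_numerical_rh_iff_inStrip.1 hPT
  -- the arch density and its bounds
  have hdh : (0 : ℚ) < ktKernel.h := by norm_num [ktKernel]
  have hdL : ((ktKernel.L : ℚ) : ℝ) = 2 * (107 / 40) := by norm_num [ktKernel]
  have hdL0 : (0 : ℚ) ≤ ktKernel.L := by norm_num [ktKernel]
  have hN : Real.exp (2 * (107 / 40)) < (210 : ℕ) + 1 := by
    rw [show (2 : ℝ) * (107 / 40) = 107 / 20 by norm_num]; push_cast; linarith [exp_535_lt]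
  have hA := isArchDensity_archDensity hdh hdL hN
  have hC := decayConst_ktKernel_le
  have hLB : ∀ y : ℝ, |y| ≤ 4 * (10 : ℝ) ^ 10 → -(43723 / 10000 + 4 * 108 : ℝ) ≤ archDensity ktKernel y := by
    intro y _
    have := archDensity_lowBand hdL0 hdh y
    norm_num at this ⊢
    linarith
  have hHF : ∀ y : ℝ, 4 * (10 : ℝ) ^ 10 < |y| → (20 : ℝ) + 1 ≤ archDensity ktKernel y := by
    intro y hy
    have h := archDensity_highFreq hdL0 hdh (Y := 4 * (10 : ℝ) ^ 10) (by norm_num) hy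
    refine le_trans ?_ h
    have hlog : (237 / 10 : ℝ) ≤ Real.log (4 * (10 : ℝ) ^ 10 / 2) := by
      rw [Real.le_log_iff_exp_le (by norm_num)]
      exact exp_237_10_le.trans (by norm_num)
    have hpi := Real.pi_lt_d2
    have hlpi := Real.log_pi_le
    have hE : ktKernel.decayConst / (1 / 4 + (4 * (10 : ℝ) ^ 10) ^ 2) ≤ 108 / (1 / 4 + (4 * (10 : ℝ) ^ 10) ^ 2) :=
      div_le_div_of_nonneg_right hC (by positivity)
    have hpi2 : π / (2 * (4 * (10 : ℝ) ^ 10)) ≤ 3.15 / (2 * (4 * (10 : ℝ) ^ 10)) :=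
      div_le_div_of_nonneg_right hpi.le (by positivity)
    norm_num at hE hpi2 ⊢
    linarith
  -- the Krein–Turán bound
  have hKT : ∀ v : ℝ → ℂ, IsWeilTest v → tsupport v ⊆ Icc (-(107 / 40 : ℝ)) (107 / 40) →
      ∑ n ∈ Finset.range (210 + 1), 2 * Λ n / Real.sqrt n * ((weilConv v (weilReflect v)) (Real.log n)).re ≤
        20 * weilNorm2Sq v := by
    intro v hv hvs
    exact kreinTuranBound_210 v hv (by rw [show (107 / 20 / 2 : ℝ) = 107 / 40 by norm_num]; exact hvs)
  -- numerical side conditions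
  have hcosh : Real.cosh ((1 : ℝ) / (4 * 10 ^ 11) / 2) ≤ 10001 / 10000 := by
    refine (cosh_le_one_add_sq (by rw [abs_of_pos (by positivity)]; norm_num)).trans (by norm_num)
  have hHh : Real.cosh ((1 : ℝ) / (4 * 10 ^ 11) / 2) ≤ (1 : ℝ) / (4 * 10 ^ 11) * 3000175332800 :=
    hcosh.trans (by norm_num)
  have hτ : 6 * (1337 / 500 : ℝ) * Real.exp (1337 / 500) *
      (Real.cosh ((1 : ℝ) / (4 * 10 ^ 11) / 2) / ((1 : ℝ) / (4 * 10 ^ 11))) ^ (2 * (9 + 1)) /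
        (3000175332800 : ℝ) ^ (2 * (9 + 1) - 2) * ((986 / 100) / 3000175332800) ≤ 22 / 1000 := by
    have he := exp_2674_le
    have hP : 0 ≤ (Real.cosh ((1 : ℝ) / (4 * 10 ^ 11) / 2) / ((1 : ℝ) / (4 * 10 ^ 11))) ^ (2 * (9 + 1)) := by positivity
    calc 6 * (1337 / 500 : ℝ) * Real.exp (1337 / 500) *
          (Real.cosh ((1 : ℝ) / (4 * 10 ^ 11) / 2) / ((1 : ℝ) / (4 * 10 ^ 11))) ^ (2 * (9 + 1)) /
            (3000175332800 : ℝ) ^ (2 * (9 + 1) - 2) * ((986 / 100) / 3000175332800)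
        ≤ 6 * (1337 / 500 : ℝ) * (29 / 2) * ((10001 / 10000 : ℝ) / ((1 : ℝ) / (4 * 10 ^ 11))) ^ (2 * (9 + 1)) /
            (3000175332800 : ℝ) ^ (2 * (9 + 1) - 2) * ((986 / 100) / 3000175332800) := by
          gcongr
      _ ≤ 22 / 1000 := by norm_num
  suffices h0 : 0 ≤ (weilFunctional (weilConv g (weilReflect g))).re + weilNorm2Sq g by linarith
  refine unitSlackWeil_of_rhUpTo_kreinTuran hg (b := 1337 / 500) (by norm_num) hs (h := (1 : ℝ) / (4 * 10 ^ 11))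
    (by positivity) (m := 9) (b' := 107 / 40) (by norm_num) (H := 3000175332800) (Θ := (986 / 100) / 3000175332800)
    (by norm_num) hRH tailInvImSq_plattTrudgian_le hHh hA (Pup := 20) (by norm_num) hKT (Y := 4 * (10 : ℝ) ^ 10)
    (B := 43723 / 10000 + 4 * 108) (by positivity) (by norm_num) (by norm_num) hHF hLB ?_
  norm_num at hτ ⊢
  linarith

/-- **`SignConeOscillatory` for all cutoffs `a ≤ 1337/500`, conditional on Platt–Trudgian** (body verbatim over Mathlib
primitives; honest weights, unit slack from `unitSlackWeil_log210_of_plattTrudgian`). [cite: PlattTrudgianBLMS2021, Theorem 1] -/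
theorem signConeOscillatory_upTo_2674_of_plattTrudgian (hPT : platt_trudgian_numerical_rh) :
    ∀ a : ℝ, 0 < a → a ≤ 1337 / 500 → ∀ (k : ℕ) (g : Fin k → ℝ → ℂ), (∀ i, (ContDiff ℝ ((⊤ : ℕ∞) : WithTop ℕ∞) (g i) ∧ HasCompactSupport (g i)) ∧ tsupport (g i) ⊆ Set.Icc (-a) a) → let F : ℝ → ℂ := fun t => ∑ i, MeasureTheory.convolution (g i) (fun u => (starRingEnd ℂ) ((g i) (-u))) (ContinuousLinearMap.mul ℂ ℂ) MeasureTheory.MeasureSpace.volume t; (∀ n : ℕ, 2 ≤ n → 0 ≤ (F (Real.log n)).re) → (∃ t : ℝ, Real.log 2 ≤ |t| ∧ (F t).re < 0) → let M : ℂ → ℂ := fun s => ∫ u : ℝ, F u * Complex.exp ((s - 1 / 2) * u); -(F 0).re ≤ (M 0 + M 1 + ((1 / (2 * Real.pi) : ℂ) * (∫ t : ℝ, M (1 / 2 + t * Complex.I) * ((Complex.digamma (1 / 4 + t / 2 * Complex.I)).re : ℂ)) - F 0 * (Real.log Real.pi : ℂ))).re := by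
  refine signConeOscillatory_upTo_of_fakeWeight_unitSlack (b := 1337 / 500) (c := fun n => Λ n)
    (fun n => ArithmeticFunction.vonMangoldt_nonneg) fun g hg hs => ?_
  have h := unitSlackWeil_log210_of_plattTrudgian hPT g hg hs
  unfold weilFunctional weilPrimeTerm at h
  unfold weilNorm2Sq at h
  rw [show weilPolarTerm (weilConv g (weilReflect g)) + weilArchTerm (weilConv g (weilReflect g)) -
      ∑' n : ℕ, ((Λ n : ℝ) : ℂ) / (Real.sqrt n : ℂ) * (weilConv g (weilReflect g) (Real.log n) +
        weilConv g (weilReflect g) (-Real.log n)) =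
      weilPolarTerm (weilConv g (weilReflect g)) - ∑' n : ℕ, ((Λ n : ℝ) : ℂ) / (Real.sqrt n : ℂ) *
        (weilConv g (weilReflect g) (Real.log n) + weilConv g (weilReflect g) (-Real.log n)) +
          weilArchTerm (weilConv g (weilReflect g)) by ring]
  exact h

/-- **`SignConeInequality` for all cutoffs `a ≤ 1337/500`, conditional on Platt–Trudgian** (the route's target body, restricted
to `a ≤ 1337/500 = 2.674`). [cite: PlattTrudgianBLMS2021, Theorem 1] -/
theorem signConeInequality_upTo_2674_of_plattTrudgian (hPT : platt_trudgian_numerical_rh) :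
    ∀ a : ℝ, 0 < a → a ≤ 1337 / 500 → ∀ (k : ℕ) (g : Fin k → ℝ → ℂ), (∀ i, (ContDiff ℝ ((⊤ : ℕ∞) : WithTop ℕ∞) (g i) ∧ HasCompactSupport (g i)) ∧ tsupport (g i) ⊆ Set.Icc (-a) a) → let F : ℝ → ℂ := fun t => ∑ i, MeasureTheory.convolution (g i) (fun u => (starRingEnd ℂ) ((g i) (-u))) (ContinuousLinearMap.mul ℂ ℂ) MeasureTheory.MeasureSpace.volume t; (∀ n : ℕ, 2 ≤ n → 0 ≤ (F (Real.log n)).re) → let M : ℂ → ℂ := fun s => ∫ u : ℝ, F u * Complex.exp ((s - 1 / 2) * u); -(F 0).re ≤ (M 0 + M 1 + ((1 / (2 * Real.pi) : ℂ) * (∫ t : ℝ, M (1 / 2 + t * Complex.I) * ((Complex.digamma (1 / 4 + t / 2 * Complex.I)).re : ℂ)) - F 0 * (Real.log Real.pi : ℂ))).re := by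
  intro a _ha hab k g hg F hn M
  have hW : ∀ g : ℝ → ℂ, IsWeilTest g → tsupport g ⊆ Icc (-(1337 / 500 : ℝ)) (1337 / 500) →
      -(∫ t, ‖g t‖ ^ 2) ≤ (weilPolarTerm (weilConv g (weilReflect g)) + weilArchTerm (weilConv g (weilReflect g)) -
        ∑' n : ℕ, (((fun n => Λ n) n : ℝ) : ℂ) / (Real.sqrt n : ℂ) *
          (weilConv g (weilReflect g) (Real.log n) + weilConv g (weilReflect g) (-Real.log n))).re := by
    intro g hg hs
    have h := unitSlackWeil_log210_of_plattTrudgian hPT g hg hs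
    unfold weilFunctional weilPrimeTerm at h
    unfold weilNorm2Sq at h
    rw [show weilPolarTerm (weilConv g (weilReflect g)) + weilArchTerm (weilConv g (weilReflect g)) -
        ∑' n : ℕ, (((fun n => Λ n) n : ℝ) : ℂ) / (Real.sqrt n : ℂ) * (weilConv g (weilReflect g) (Real.log n) +
          weilConv g (weilReflect g) (-Real.log n)) =
        weilPolarTerm (weilConv g (weilReflect g)) - ∑' n : ℕ, ((Λ n : ℝ) : ℂ) / (Real.sqrt n : ℂ) *
          (weilConv g (weilReflect g) (Real.log n) + weilConv g (weilReflect g) (-Real.log n)) +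
            weilArchTerm (weilConv g (weilReflect g)) by ring]
    exact h
  exact neg_re_apply_zero_le_re_weilArchPolar_of_fakeWeight_unitSlack (b := 1337 / 500) (c := fun n => Λ n)
    (fun n => ArithmeticFunction.vonMangoldt_nonneg) hW (g := g) (F := F) rfl (fun i => (hg i).1)
    (fun i => (hg i).2.trans (Icc_subset_Icc (neg_le_neg hab) hab)) hn

/-- **`SignConeInequality` up to the 2001 benchmark `a ≤ (log 210)/2` (`x = e^{2a} ≤ 210`), conditional on Platt–Trudgian** —
the body of the support item `SignConeUpTo210` (stmt-RiemannHypothesis-17940) in its honest fact-conditional form.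
[cite: PlattTrudgianBLMS2021, Theorem 1] -/
theorem signConeInequality_upTo_log210half_of_plattTrudgian (hPT : platt_trudgian_numerical_rh) :
    ∀ a : ℝ, 0 < a → a ≤ Real.log 210 / 2 → ∀ (k : ℕ) (g : Fin k → ℝ → ℂ), (∀ i, (ContDiff ℝ ((⊤ : ℕ∞) : WithTop ℕ∞) (g i) ∧ HasCompactSupport (g i)) ∧ tsupport (g i) ⊆ Set.Icc (-a) a) → let F : ℝ → ℂ := fun t => ∑ i, MeasureTheory.convolution (g i) (fun u => (starRingEnd ℂ) ((g i) (-u))) (ContinuousLinearMap.mul ℂ ℂ) MeasureTheory.MeasureSpace.volume t; (∀ n : ℕ, 2 ≤ n → 0 ≤ (F (Real.log n)).re) → let M : ℂ → ℂ := fun s => ∫ u : ℝ, F u * Complex.exp ((s - 1 / 2) * u); -(F 0).re ≤ (M 0 + M 1 + ((1 / (2 * Real.pi) : ℂ) * (∫ t : ℝ, M (1 / 2 + t * Complex.I) * ((Complex.digamma (1 / 4 + t / 2 * Complex.I)).re : ℂ)) - F 0 * (Real.log Real.pi : ℂ))).re :=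
  fun a ha hab => signConeInequality_upTo_2674_of_plattTrudgian hPT a ha (hab.trans log_210_half_le)

/-- **`SignConeOscillatory` up to `a ≤ (log 210)/2`, conditional on Platt–Trudgian.** [cite: PlattTrudgianBLMS2021, Theorem 1] -/
theorem signConeOscillatory_upTo_log210half_of_plattTrudgian (hPT : platt_trudgian_numerical_rh) :
    ∀ a : ℝ, 0 < a → a ≤ Real.log 210 / 2 → ∀ (k : ℕ) (g : Fin k → ℝ → ℂ), (∀ i, (ContDiff ℝ ((⊤ : ℕ∞) : WithTop ℕ∞) (g i) ∧ HasCompactSupport (g i)) ∧ tsupport (g i) ⊆ Set.Icc (-a) a) → let F : ℝ → ℂ := fun t => ∑ i, MeasureTheory.convolution (g i) (fun u => (starRingEnd ℂ) ((g i) (-u))) (ContinuousLinearMap.mul ℂ ℂ) MeasureTheory.MeasureSpace.volume t; (∀ n : ℕ, 2 ≤ n → 0 ≤ (F (Real.log n)).re) → (∃ t : ℝ, Real.log 2 ≤ |t| ∧ (F t).re < 0) → let M : ℂ → ℂ := fun s => ∫ u : ℝ, F u * Complex.exp ((s - 1 / 2) * u); -(F 0).re ≤ (M 0 + M 1 + ((1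 / (2 * Real.pi) : ℂ) * (∫ t : ℝ, M (1 / 2 + t * Complex.I) * ((Complex.digamma (1 / 4 + t / 2 * Complex.I)).re : ℂ)) - F 0 * (Real.log Real.pi : ℂ))).re :=
  fun a ha hab => signConeOscillatory_upTo_2674_of_plattTrudgian hPT a ha (hab.trans log_210_half_le)

end Summit.RiemannHypothesis.RiemannHypothesis.Theorems.SignCone

end
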